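import Mathlib
import Summits.ResolutionOfSingularities.ResolutionOfSingularities.Theorems.WeightedInvariantLocalWeightedDropNCPolyBridgeRepresents

/-!
# TOT2-LINE (P3) brick B0: DEFINITIONS of the CONFLICT BUDGET — top-locus primes, the canonical branch valuation, pair terms, the budget

Sub-problem `ResolutionOfSingularities`, ENGINE crux `stmt-ResolutionOfSingularities-8899` (`LocalWeightedDrop`), skeleton v35 (2e806da509994632),
registered stub `stub_conflictBudget` (P3): `∃ M : (d : ℕ) → (Fin d → k⟦u₁,u₂⟧) → Finset (Fin 2) → ℕ` not raised by the in-regime successors of the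
lazy selector strategy and lowered by the point family at conflict states.  [OURS · L1 W4.3 · chain w43 · res-L1-w43-stub-2 g6, owner of (P3) per
res-L1-w43-plan-1's RE-DEAL 2026-08-27T19:29:55Z; the objects of `L/res-L1-w43-stub-2/g6/CONFLICT-BUDGET-DESIGN-v1.md` (evidence n=57 on 8899) §2.
«[OURS · L1 W4.3] replaces the role of nothing printed; NOT a statement of the manuscript»: the game, its labels and this bookkeeping are the
programme's own; the normalisation of a complete one-dimensional local domain (Kiyek–Vicente II (3.17), Matsumura 29.7) enters only through the
tree's `Literature.AlgebraicGeometry.Resolution.CompleteLocalDomainNormalization*` when the definitions are USED (brick B2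
`…TOT2BranchValuation`).  AI-produced, gate-checked, weaker than expert review.]

THE MODEL (design v1 §1).  The top locus `T = Sing_d(F)`, `F = NCPoly.monicGerm d A = y^d + Σ A_j y^j ∈ R₃ = k⟦u₁,u₂,y⟧`, is a finite union of
curve branches through the origin; a branch is a non-maximal prime `P` of `R₃` with `F ∈ P^(d)` (SYMBOLIC power: `∃ s ∉ P, s·F ∈ P^d` — ordinary
powers would miss singular branches).  Its branch ring `R₃ ⧸ P` is a complete one-dimensional local domain whose normalisation `W_P` is a discrete
valuation ring `≅ k⟦T⟧`; the CANONICAL VALUATION `v_P(f) := addVal_{W_P}(f mod P)` measures every contact number the budget needs: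
`v_P(u₁)`, `v_P(u₂)` (intersection numbers of the plane projection of the branch with the two axes), their minimum (its multiplicity), and
`pair(P,P′) = min { v_P(g) : g ∈ k⟦u₁,u₂⟧, g ∈ P′ ∖ P }` (intersection number of the two plane projections).  THE BUDGET (design v1 §2):
`M d A N = Σ_{P ∈ T°} charge(P) + 2·Σ_{P ≠ P′ ∈ T°} pair(P,P′)`, `T°` = branches containing neither `u₁` nor `u₂`,
`charge(P) = 2·v_P(u₁) + β₂·(2·(v_P(u₂) − m_P) + [v_P(u₁) = v_P(u₂) = 1])`, `β₂ = [u₂ ∈ N ∨ V(y,u₂) permissible]`.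

* `TOT2Branch.topPrimes d A`, `TOT2Branch.topPrimesNL d A` — the branches / the non-line branches;
* `TOT2Branch.branchVal P f : ℕ∞` — the canonical valuation (junk `⊤` when `P` is not prime or the normalisation is not a DVR);
* `TOT2Branch.toThree` — the inclusion `k⟦u₁,u₂⟧ → k⟦u₁,u₂,y⟧`; `TOT2Branch.pairVal P P′ : ℕ∞` — the pair term;
* `TOT2Branch.betaTwo`, `TOT2Branch.kappa`, `TOT2Branch.charge`, **`TOT2Branch.conflictBudget d A N : ℕ`** — the budget (finite sums as `finsum`,
  `ℕ∞` read through `toNat`; junk `0` off the finiteness/normalisation context, which the laws never meet).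
Only definitions and their unfoldings.
-/

set_option linter.dupNamespace false -- mandated namespace of this single-conjunct summit

noncomputable section

namespace Summit.ResolutionOfSingularities.ResolutionOfSingularities.Theorems

namespace TOT2Branch

open MvPowerSeries IsLocalRing

variable {k : Type} [Field k]

/-! ## Top-locus primes -/

/-- THE TOP-LOCUS PRIMES of a label `A` of degree `d`: the non-maximal primes `P` of `k⟦u₁,u₂,y⟧` with the monic germ `y^d + Σ A_j y^j` in the
SYMBOLIC `d`-th power `P^(d)` (`∃ s ∉ P, s·F ∈ P^d`: multiplicity `d` at the generic point of the branch `V(P)`).  Finite under the regime's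
presentation context (stub-1's `NCBranchPrimes.finite_primes_of_monicGerm_mul_mem_pow`, same spelling). -/
def topPrimes (d : ℕ) (A : Fin d → MvPowerSeries (Fin 2) k) : Set (Ideal (MvPowerSeries (Fin 3) k)) :=
  {P | P.IsPrime ∧ P ≠ maximalIdeal (MvPowerSeries (Fin 3) k) ∧ ∃ s, s ∉ P ∧ s * NCPoly.monicGerm d A ∈ P ^ d}

/-- THE NON-LINE TOP-LOCUS PRIMES: the branches lying over neither coordinate axis of the `(u₁,u₂)`-plane (`u₁ ∉ P`, `u₂ ∉ P`); the line branches
(`V(y,u₁)`, `V(y,u₂)` for regime labels) carry no charge. -/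
def topPrimesNL (d : ℕ) (A : Fin d → MvPowerSeries (Fin 2) k) : Set (Ideal (MvPowerSeries (Fin 3) k)) :=
  {P | P ∈ topPrimes d A ∧ (X 0 : MvPowerSeries (Fin 3) k) ∉ P ∧ (X 1 : MvPowerSeries (Fin 3) k) ∉ P}

/-! ## The canonical valuation of a branch -/

open Classical in
/-- THE CANONICAL VALUATION `v_P(f)` OF `f` ALONG THE BRANCH `P`: the additive valuation, in the normalisation `W_P` of the branch ring
`k⟦u₁,u₂,y⟧ ⧸ P` (a discrete valuation ring when `P` is a one-dimensional prime — `…TOT2BranchValuation`), of the class of `f`.  No choice is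
involved.  Junk value `⊤` when `P` is not prime or `W_P` is not a discrete valuation ring. -/
def branchVal (P : Ideal (MvPowerSeries (Fin 3) k)) (f : MvPowerSeries (Fin 3) k) : ℕ∞ :=
  if hP : P.IsPrime then
    haveI := hP
    if hW : IsDiscreteValuationRing
        (integralClosure (MvPowerSeries (Fin 3) k ⧸ P) (FractionRing (MvPowerSeries (Fin 3) k ⧸ P))) then
      haveI := hW
      IsDiscreteValuationRing.addVal (integralClosure (MvPowerSeries (Fin 3) k ⧸ P) (FractionRing (MvPowerSeries (Fin 3) k ⧸ P)))
        (algebraMap (MvPowerSeries (Fin 3) k ⧸ P) _ (Ideal.Quotient.mk P f))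
    else ⊤
  else ⊤

/-- THE MULTIPLICITY of (the plane projection of) the branch: `min (v_P(u₁), v_P(u₂))`. -/
def branchMult (P : Ideal (MvPowerSeries (Fin 3) k)) : ℕ∞ := min (branchVal P (X 0)) (branchVal P (X 1))

/-! ## Pair terms -/

/-- The inclusion `k⟦u₁,u₂⟧ → k⟦u₁,u₂,y⟧` (`y` the last variable, as in `NCPoly.monicGerm`). -/
def toThree : MvPowerSeries (Fin 2) k →ₐ[k] MvPowerSeries (Fin 3) k := rename (Fin.succAboveEmb (Fin.last 2))

/-- THE PAIR TERM `pair(P,P′)`: the least value along `P` of a `(u₁,u₂)`-series lying in `P′` but not in `P` (the intersection number of the plane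
projections of the two branches when computed at an irreducible equation of the second; `⊤` when no such series exists). -/
def pairVal (P P' : Ideal (MvPowerSeries (Fin 3) k)) : ℕ∞ :=
  ⨅ g : {g : MvPowerSeries (Fin 2) k // toThree g ∈ P' ∧ toThree g ∉ P}, branchVal P (toThree g.1)

/-! ## The budget -/

open Classical in
/-- THE LETTER BIT `β₂ ∈ {0,1}`: `1` iff `u₂` is a boundary letter or `V(y,u₂)` is permissible for the label (the only place where the boundary `N`
enters the budget). -/
def betaTwo (d : ℕ) (A : Fin d → MvPowerSeries (Fin 2) k) (N : Finset (Fin 2)) : ℕ :=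
  if (1 : Fin 2) ∈ N ∨ PolyDescent.IsPermissibleTwoT d A then 1 else 0

open Classical in
/-- THE TRANSVERSALITY BIT `κ(P) ∈ {0,1}`: `1` iff the branch is smooth and transverse to both axes (`v_P(u₁) = v_P(u₂) = 1`). -/
def kappa (P : Ideal (MvPowerSeries (Fin 3) k)) : ℕ :=
  if branchVal P (X 0) = 1 ∧ branchVal P (X 1) = 1 then 1 else 0

/-- THE CHARGE OF A BRANCH: `2·v_P(u₁) + β₂·(2·(v_P(u₂) − m_P) + κ(P))`, read in `ℕ` (`toNat`; the values are finite on non-line branches). -/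
def charge (d : ℕ) (A : Fin d → MvPowerSeries (Fin 2) k) (N : Finset (Fin 2)) (P : Ideal (MvPowerSeries (Fin 3) k)) : ℕ :=
  2 * (branchVal P (X 0)).toNat + betaTwo d A N * (2 * ((branchVal P (X 1)).toNat - (branchMult P).toNat) + kappa P)

/-- **THE CONFLICT BUDGET** `M d A N = Σ_{P ∈ T°} charge(P) + 2·Σ_{P ∈ T°} Σ_{P′ ∈ T° ∖ {P}} pair(P,P′)` (finite sums over the non-line top-locus
primes; `finsum` is `0` on an infinite support, which the laws never meet). -/
def conflictBudget (d : ℕ) (A : Fin d → MvPowerSeries (Fin 2) k) (N : Finset (Fin 2)) : ℕ :=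
  (∑ᶠ P ∈ topPrimesNL d A, charge d A N P) + 2 * ∑ᶠ P ∈ topPrimesNL d A, ∑ᶠ P' ∈ topPrimesNL d A \ {P}, (pairVal P P').toNat

/-! ## Unfoldings -/

/-- Membership in `topPrimes`. -/
theorem mem_topPrimes_iff {d : ℕ} {A : Fin d → MvPowerSeries (Fin 2) k} {P : Ideal (MvPowerSeries (Fin 3) k)} :
    P ∈ topPrimes d A ↔ P.IsPrime ∧ P ≠ maximalIdeal (MvPowerSeries (Fin 3) k) ∧ ∃ s, s ∉ P ∧ s * NCPoly.monicGerm d A ∈ P ^ d := Iff.rfl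

/-- Membership in `topPrimesNL`. -/
theorem mem_topPrimesNL_iff {d : ℕ} {A : Fin d → MvPowerSeries (Fin 2) k} {P : Ideal (MvPowerSeries (Fin 3) k)} :
    P ∈ topPrimesNL d A ↔ P ∈ topPrimes d A ∧ (X 0 : MvPowerSeries (Fin 3) k) ∉ P ∧ (X 1 : MvPowerSeries (Fin 3) k) ∉ P := Iff.rfl

/-- `topPrimesNL ⊆ topPrimes`. -/
theorem topPrimesNL_subset (d : ℕ) (A : Fin d → MvPowerSeries (Fin 2) k) : topPrimesNL d A ⊆ topPrimes d A := fun _ h => h.1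

/-- The set of top-locus primes in stub-1's spelling (for `NCBranchPrimes.finite_primes_of_monicGerm_mul_mem_pow`). -/
theorem topPrimes_eq (d : ℕ) (A : Fin d → MvPowerSeries (Fin 2) k) : topPrimes d A =
    {P : Ideal (MvPowerSeries (Fin 3) k) | P.IsPrime ∧ P ≠ maximalIdeal (MvPowerSeries (Fin 3) k) ∧ ∃ s, s ∉ P ∧ s * NCPoly.monicGerm d A ∈ P ^ d} :=
  rfl

/-- `branchVal` unfolded on a prime whose normalisation is a discrete valuation ring. -/
theorem branchVal_eq {P : Ideal (MvPowerSeries (Fin 3) k)} [P.IsPrime]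
    (hW : IsDiscreteValuationRing (integralClosure (MvPowerSeries (Fin 3) k ⧸ P) (FractionRing (MvPowerSeries (Fin 3) k ⧸ P))))
    (f : MvPowerSeries (Fin 3) k) :
    branchVal P f =
      haveI := hW
      IsDiscreteValuationRing.addVal (integralClosure (MvPowerSeries (Fin 3) k ⧸ P) (FractionRing (MvPowerSeries (Fin 3) k ⧸ P)))
        (algebraMap (MvPowerSeries (Fin 3) k ⧸ P) _ (Ideal.Quotient.mk P f)) := by
  rw [branchVal, dif_pos ‹P.IsPrime›, dif_pos hW]

/-- `branchVal` is `⊤` off primes. -/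
theorem branchVal_of_not_isPrime {P : Ideal (MvPowerSeries (Fin 3) k)} (hP : ¬ P.IsPrime) (f : MvPowerSeries (Fin 3) k) : branchVal P f = ⊤ := by
  rw [branchVal, dif_neg hP]

/-- `toThree` on variables: `u_i ↦ X (castSucc i)`. -/
theorem toThree_X (i : Fin 2) : toThree (X i : MvPowerSeries (Fin 2) k) = X (Fin.castSucc i) := by
  rw [toThree, rename_X]
  change X (Fin.succAbove (Fin.last 2) i) = _
  rw [Fin.succAbove_last]

/-- The monic germ in terms of `toThree`. -/
theorem monicGerm_eq (d : ℕ) (A : Fin d → MvPowerSeries (Fin 2) k) :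
    NCPoly.monicGerm d A = X (Fin.last 2) ^ d + ∑ j : Fin d, toThree (A j) * X (Fin.last 2) ^ (j : ℕ) := rfl

/-- Unfolding of `pairVal` as an infimum. -/
theorem pairVal_le {P P' : Ideal (MvPowerSeries (Fin 3) k)} {g : MvPowerSeries (Fin 2) k} (hg : toThree g ∈ P') (hg' : toThree g ∉ P) :
    pairVal P P' ≤ branchVal P (toThree g) :=
  iInf_le (fun g : {g : MvPowerSeries (Fin 2) k // toThree g ∈ P' ∧ toThree g ∉ P} => branchVal P (toThree g.1)) ⟨g, hg, hg'⟩

/-- `betaTwo` unfolded. -/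
theorem betaTwo_eq_one_iff {d : ℕ} {A : Fin d → MvPowerSeries (Fin 2) k} {N : Finset (Fin 2)} :
    betaTwo d A N = 1 ↔ (1 : Fin 2) ∈ N ∨ PolyDescent.IsPermissibleTwoT d A := by
  unfold betaTwo; split_ifs with h <;> simp [h]

/-- `betaTwo` unfolded (zero case). -/
theorem betaTwo_eq_zero_iff {d : ℕ} {A : Fin d → MvPowerSeries (Fin 2) k} {N : Finset (Fin 2)} :
    betaTwo d A N = 0 ↔ ¬ ((1 : Fin 2) ∈ N ∨ PolyDescent.IsPermissibleTwoT d A) := by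
  unfold betaTwo; split_ifs with h <;> simp [h]

/-- `betaTwo ≤ 1`. -/
theorem betaTwo_le_one (d : ℕ) (A : Fin d → MvPowerSeries (Fin 2) k) (N : Finset (Fin 2)) : betaTwo d A N ≤ 1 := by
  unfold betaTwo; split_ifs <;> simp

/-- `kappa` unfolded. -/
theorem kappa_eq_one_iff {P : Ideal (MvPowerSeries (Fin 3) k)} : kappa P = 1 ↔ branchVal P (X 0) = 1 ∧ branchVal P (X 1) = 1 := by
  unfold kappa; split_ifs with h <;> simp [h]

/-- `kappa ≤ 1`. -/
theorem kappa_le_one (P : Ideal (MvPowerSeries (Fin 3) k)) : kappa P ≤ 1 := by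
  unfold kappa; split_ifs <;> simp

/-- `charge` unfolded. -/
theorem charge_eq (d : ℕ) (A : Fin d → MvPowerSeries (Fin 2) k) (N : Finset (Fin 2)) (P : Ideal (MvPowerSeries (Fin 3) k)) :
    charge d A N P = 2 * (branchVal P (X 0)).toNat + betaTwo d A N * (2 * ((branchVal P (X 1)).toNat - (branchMult P).toNat) + kappa P) := rfl

/-- `conflictBudget` unfolded. -/
theorem conflictBudget_eq (d : ℕ) (A : Fin d → MvPowerSeries (Fin 2) k) (N : Finset (Fin 2)) :
    conflictBudget d A N =
      (∑ᶠ P ∈ topPrimesNL d A, charge d A N P) + 2 * ∑ᶠ P ∈ topPrimesNL d A, ∑ᶠ P' ∈ topPrimesNL d A \ {P}, (pairVal P P').toNat := rfl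

end TOT2Branch

end Summit.ResolutionOfSingularities.ResolutionOfSingularities.Theorems

end
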